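import Mathlib
import Summits.ResolutionOfSingularities.ResolutionOfSingularities.Theorems.WildQuotientsWildQuotientResolutionJordanThreeOrder
import Summits.ResolutionOfSingularities.ResolutionOfSingularities.Theorems.WildQuotientsWildQuotientResolutionLinearSmallBlocksAlgebra

/-!
# Rung V3, stage 0: the centre `(x_a, x_b)` of the `J₃` tower is the augmentation ideal and is `⟨σ⟩`-stable

(crux stmt-ResolutionOfSingularities-15640 `WildQuotients.WildQuotientResolution`, line `Sketch`,
sector `|G| = p`; rung V3 of `L/w45c/CHAIN.md` v4 §4 row stub-1 «V3-ALGEBRA», hand computation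
`L/w45c/CRUX-PLAN.md` v4 §V3.1 step 1 (planner res-L1-w45c-plan-1); [OURS · L1 W4.5c] — NOT a
statement of any manuscript; replaces the role of no printed item.)

The `J₃` datum on `k[x] = k[x₀,…,x_{n-1}]`: `σ x_b = x_b + x_a`, `σ x_c = x_c + x_b`, identity on the
other coordinates (`a, b, c` distinct). For EVERY `g ∈ ⟨σ⟩` (the divisorial hypothesis of the cyclic
transfer quantifies over all `g ≠ 1`; `g = σᵐ` acts by `g x_b = x_b + m x_a`,
`g x_c = x_c + m x_b + (m choose 2) x_a`):
* `smul_sub_mem_centre` — `g • r - r ∈ (x_a, x_b)` for every `r`;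
* `smul_centre_eq` — `g • (x_a, x_b) = (x_a, x_b)`: the first centre `C₀ = V(x_a, x_b)` is
  `⟨σ⟩`-stable although `x_b` is not fixed (hypothesis of `AffineQuotient.idealSheaf_comap_specAction`
  / `IsBlowup.liftAction`);
* `span_smul_sub_eq_centre` — over a field of characteristic `3` and for `g ≠ 1`:
  `⟨g • f - f : f⟩ = (x_a, x_b)` EXACTLY: the first centre IS the augmentation ideal (`x_a` by
  `LinearSmallBlocks.X_mem_augIdeal_of_transvection` at the pair `(a, b)`, `x_b` from
  `g x_c - x_c = m x_b + (m choose 2) x_a`, `JordanThree.pow_apply_X_c`).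
The chart identities of the three blow-ups are in `…JordanThreeChartAlgebra`.
-/

-- single-problem summit: the doubled namespace component `ResolutionOfSingularities` is forced
set_option linter.dupNamespace false

noncomputable section

open MvPolynomial
open scoped Pointwise

namespace Summit.ResolutionOfSingularities.ResolutionOfSingularities.Theorems.WildQuotientResolution.JordanThree

/-! ## §0 Stage 0: the centre `(x_a, x_b)` is the augmentation ideal and is `⟨σ⟩`-stable -/

section StageZero

variable (k : Type) [Field k] (n : ℕ) (σ : MvPolynomial (Fin n) k ≃ₐ[k] MvPolynomial (Fin n) k)
  (a b c : Fin n) (hab : a ≠ b) (hac : a ≠ c)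
  (hb : σ (X b) = X b + X a) (hc : σ (X c) = X c + X b)
  (hσ : ∀ i, i ≠ b → i ≠ c → σ (X i) = X i)

include hb hc hσ in
/-- `σ xᵢ - xᵢ ∈ (x_a, x_b)` for every coordinate (it is `x_a`, `x_b` or `0`). [folklore] -/
theorem apply_X_sub_X_mem_centre (i : Fin n) :
    σ (X i) - X i ∈ Ideal.span ({X a, X b} : Set (MvPolynomial (Fin n) k)) := by
  by_cases hib : i = b
  · subst hib
    rw [hb, add_sub_cancel_left]
    exact Ideal.subset_span (Set.mem_insert _ _)
  by_cases hic : i = c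
  · subst hic
    rw [hc, add_sub_cancel_left]
    exact Ideal.subset_span (Set.mem_insert_of_mem _ (Set.mem_singleton _))
  · rw [hσ i hib hic, sub_self]
    exact Ideal.zero_mem _

include hb hc hσ in
/-- **`g • r ≡ r` modulo the centre `(x_a, x_b)`** for every `g ∈ ⟨σ⟩` and every `r ∈ k[x]`: on the
generators by `apply_X_sub_X_mem_centre`, multiplicativity, then `σ⁻¹` and integer powers (pattern
`LinearSmallBlocks.smul_sub_mem_centre`). [folklore] -/
theorem smul_sub_mem_centre (g : Subgroup.zpowers σ) (r : MvPolynomial (Fin n) k) :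
    g • r - r ∈ Ideal.span ({X a, X b} : Set (MvPolynomial (Fin n) k)) := by
  classical
  set I : Ideal (MvPolynomial (Fin n) k) := Ideal.span ({X a, X b} : Set (MvPolynomial (Fin n) k))
    with hI
  obtain ⟨z, hz⟩ := Subgroup.mem_zpowers_iff.mp g.2
  have hσX : ∀ i : Fin n, σ (X i) - X i ∈ I := apply_X_sub_X_mem_centre k n σ a b c hb hc hσ
  have hσf : ∀ r : MvPolynomial (Fin n) k, σ r - r ∈ I := by
    intro r
    induction r using MvPolynomial.induction_on with
    | C c =>
      have hc' : σ (C c) = C c := σ.commutes c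
      rw [hc', sub_self]; exact Ideal.zero_mem _
    | add r r' hr hr' =>
      have : σ (r + r') - (r + r') = (σ r - r) + (σ r' - r') := by rw [map_add]; ring
      rw [this]; exact Ideal.add_mem _ hr hr'
    | mul_X r i hr =>
      have : σ (r * X i) - r * X i = (σ r - r) * σ (X i) + r * (σ (X i) - X i) := by
        rw [map_mul]; ring
      rw [this]
      exact Ideal.add_mem _ (Ideal.mul_mem_right _ _ hr) (Ideal.mul_mem_left _ _ (hσX i))
  have hσinvf : ∀ r : MvPolynomial (Fin n) k, σ⁻¹ r - r ∈ I := by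
    intro r
    have h := hσf (σ⁻¹ r)
    have e : σ (σ⁻¹ r) = r := by rw [← AlgEquiv.mul_apply, mul_inv_cancel, AlgEquiv.one_apply]
    rw [e] at h
    have : σ⁻¹ r - r = -(r - σ⁻¹ r) := by ring
    rw [this]
    exact neg_mem h
  have hzpow : ∀ (z : ℤ) (r : MvPolynomial (Fin n) k), (σ ^ z) r - r ∈ I := by
    intro z
    induction z using Int.induction_on with
    | zero => intro r; rw [zpow_zero, AlgEquiv.one_apply, sub_self]; exact Ideal.zero_mem _
    | succ m ih =>
      intro r
      rw [zpow_add_one, AlgEquiv.mul_apply]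
      have e : (σ ^ (m : ℤ)) (σ r) - r = ((σ ^ (m : ℤ)) (σ r) - σ r) + (σ r - r) := by ring
      rw [e]
      exact Ideal.add_mem _ (ih (σ r)) (hσf r)
    | pred m ih =>
      intro r
      rw [zpow_sub_one, AlgEquiv.mul_apply]
      have e : (σ ^ (-(m : ℤ))) (σ⁻¹ r) - r =
          ((σ ^ (-(m : ℤ))) (σ⁻¹ r) - σ⁻¹ r) + (σ⁻¹ r - r) := by ring
      rw [e]
      exact Ideal.add_mem _ (ih (σ⁻¹ r)) (hσinvf r)
  change (g : MvPolynomial (Fin n) k ≃ₐ[k] MvPolynomial (Fin n) k) r - r ∈ I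
  rw [← hz]
  exact hzpow z r

include hab hac hb hσ in
/-- **The centre `(x_a, x_b)` is `⟨σ⟩`-stable**: `g • (x_a, x_b) = (x_a, x_b)` — `x_b` is NOT fixed
(`σ x_b = x_b + x_a`) but the ideal is (`(x_a, x_b + x_a) = (x_a, x_b)`); this is the hypothesis of
`AffineQuotient.idealSheaf_comap_specAction` / `IsBlowup.liftAction` for step 1. [folklore] -/
theorem smul_centre_eq (g : Subgroup.zpowers σ) :
    g • Ideal.span ({X a, X b} : Set (MvPolynomial (Fin n) k)) =
      Ideal.span ({X a, X b} : Set (MvPolynomial (Fin n) k)) := by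
  have ha : σ (X a) = X a := hσ a hab hac
  -- first for `σ` itself
  have hσ1 : Ideal.map (σ : MvPolynomial (Fin n) k →+* MvPolynomial (Fin n) k)
      (Ideal.span ({X a, X b} : Set (MvPolynomial (Fin n) k))) =
        Ideal.span ({X a, X b} : Set (MvPolynomial (Fin n) k)) := by
    rw [Ideal.map_span, Set.image_pair]
    change Ideal.span {σ (X a), σ (X b)} = _
    rw [ha, hb]
    apply le_antisymm
    · refine Ideal.span_le.mpr ?_
      intro x hx
      rcases hx with rfl | hx
      · exact Ideal.subset_span (Set.mem_insert _ _)
      · rw [Set.mem_singleton_iff] at hx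
        subst hx
        exact Ideal.add_mem _ (Ideal.subset_span (Set.mem_insert_of_mem _ (Set.mem_singleton _)))
          (Ideal.subset_span (Set.mem_insert _ _))
    · refine Ideal.span_le.mpr ?_
      intro x hx
      rcases hx with rfl | hx
      · exact Ideal.subset_span (Set.mem_insert _ _)
      · rw [Set.mem_singleton_iff] at hx
        subst hx
        have h := Ideal.sub_mem _
          (Ideal.subset_span (Set.mem_insert_of_mem _ (Set.mem_singleton _)) :
            (X b + X a : MvPolynomial (Fin n) k) ∈ Ideal.span {X a, X b + X a})
          (Ideal.subset_span (Set.mem_insert _ _) :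
            (X a : MvPolynomial (Fin n) k) ∈ Ideal.span {X a, X b + X a})
        rwa [add_sub_cancel_right] at h
  have hσ' : σ • Ideal.span ({X a, X b} : Set (MvPolynomial (Fin n) k)) =
      Ideal.span ({X a, X b} : Set (MvPolynomial (Fin n) k)) := hσ1
  obtain ⟨z, hz⟩ := Subgroup.mem_zpowers_iff.mp g.2
  change (g : MvPolynomial (Fin n) k ≃ₐ[k] MvPolynomial (Fin n) k) •
      Ideal.span ({X a, X b} : Set (MvPolynomial (Fin n) k)) = _
  rw [← hz]
  exact MulAction.fixedBy_subset_fixedBy_zpow (Ideal (MvPolynomial (Fin n) k)) σ z hσ'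

include hab hac hb hc hσ in
/-- **The centre IS the augmentation ideal** (stage 0): for every `1 ≠ g ∈ ⟨σ⟩` over a field of
characteristic `3`, `⟨g • f - f : f ∈ k[x]⟩ = (x_a, x_b)`. `⊆` is `smul_sub_mem_centre`; `⊇`: `g = σᵐ`
with `3 ∤ m`, `x_a = m⁻¹ (g x_b - x_b)` (`LinearSmallBlocks.X_mem_augIdeal_of_transvection`) and
`x_b = m⁻¹ (g x_c - x_c - (m choose 2) x_a)` (`pow_apply_X_c`). [folklore] -/
theorem span_smul_sub_eq_centre [CharP k 3] (g : Subgroup.zpowers σ) (hg : g ≠ 1) :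
    Ideal.span (Set.range fun f : MvPolynomial (Fin n) k => g • f - f) =
      Ideal.span ({X a, X b} : Set (MvPolynomial (Fin n) k)) := by
  classical
  have hσ3 : σ ^ 3 = 1 := pow_three_eq_one k n σ a b c hab hac hb hc hσ
  have ha : σ (X a) = X a := hσ a hab hac
  set J := Ideal.span (Set.range fun f : MvPolynomial (Fin n) k => g • f - f) with hJ
  have hXa : (X a : MvPolynomial (Fin n) k) ∈ J :=
    LinearSmallBlocks.X_mem_augIdeal_of_transvection k 3 Nat.prime_three σ a b ha hb hσ3 g hg
  -- `g = σ ^ m` with `3 ∤ m`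
  have hfin : IsOfFinOrder σ := isOfFinOrder_iff_pow_eq_one.mpr ⟨3, by norm_num, hσ3⟩
  obtain ⟨m, hm⟩ : (g : MvPolynomial (Fin n) k ≃ₐ[k] MvPolynomial (Fin n) k) ∈ Submonoid.powers σ :=
    hfin.mem_powers_iff_mem_zpowers.mpr g.2
  have hm' : σ ^ m = (g : MvPolynomial (Fin n) k ≃ₐ[k] MvPolynomial (Fin n) k) := hm
  have hndvd : ¬ 3 ∣ m := by
    rintro ⟨l, rfl⟩
    apply hg
    apply Subtype.ext
    change (g : MvPolynomial (Fin n) k ≃ₐ[k] MvPolynomial (Fin n) k) = 1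
    rw [← hm', pow_mul, hσ3, one_pow]
  have hmk : (m : k) ≠ 0 := fun h => hndvd ((CharP.cast_eq_zero_iff k 3 m).mp h)
  have hXb : (X b : MvPolynomial (Fin n) k) ∈ J := by
    have hsmul : g • (X c : MvPolynomial (Fin n) k) - X c =
        (m : MvPolynomial (Fin n) k) * X b + ((m.choose 2 : ℕ) : MvPolynomial (Fin n) k) * X a := by
      change (g : MvPolynomial (Fin n) k ≃ₐ[k] MvPolynomial (Fin n) k) (X c) - X c = _
      rw [← hm', pow_apply_X_c k n σ a b c hab hac hb hc hσ m]
      ring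
    have hmXb : (m : MvPolynomial (Fin n) k) * X b ∈ J := by
      have e : (m : MvPolynomial (Fin n) k) * X b =
          (g • (X c : MvPolynomial (Fin n) k) - X c) -
            ((m.choose 2 : ℕ) : MvPolynomial (Fin n) k) * X a := by
        rw [hsmul]; ring
      rw [e]
      exact Ideal.sub_mem _ (Ideal.subset_span ⟨X c, rfl⟩) (Ideal.mul_mem_left _ _ hXa)
    have hx : (X b : MvPolynomial (Fin n) k) =
        C ((m : k)⁻¹) * ((m : MvPolynomial (Fin n) k) * X b) := by
      rw [← mul_assoc, ← map_natCast (C : k →+* MvPolynomial (Fin n) k) m, ← map_mul,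
        inv_mul_cancel₀ hmk, map_one, one_mul]
    rw [hx]
    exact Ideal.mul_mem_left _ _ hmXb
  apply le_antisymm
  · rw [hJ]
    refine Ideal.span_le.mpr ?_
    rintro _ ⟨f, rfl⟩
    exact smul_sub_mem_centre k n σ a b c hb hc hσ g f
  · refine Ideal.span_le.mpr ?_
    intro x hx
    rcases hx with rfl | hx
    · exact hXa
    · rw [Set.mem_singleton_iff] at hx
      subst hx
      exact hXb

end StageZero


end Summit.ResolutionOfSingularities.ResolutionOfSingularities.Theorems.WildQuotientResolution.JordanThree

end
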